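import Literature.Topology.FourManifolds.TautFoliationsHolonomy
import HarnessLib

/-!
# Holonomy of transversely oriented `C⁰` codimension-one foliations is increasing

Sibling of `TautFoliationsHolonomy.lean` (the holonomy germ of a leaf path, read off the germ
covering `GermSpace.proj : F.GermSpace → F.LeafSpace`). For a **transversely oriented** foliation
(`F.IsTransverselyOriented`: the changes of coordinates are increasing in the transverse
coordinate, Hector–Hirsch, *Introduction to the Geometry of Foliations, Part A*, Ch. II
Def. 2.2.8 (i)) the transition germs `γ_{e e'}` are *increasing* homeomorphism germs
(`TautFoliationsHolonomyCocycle.lean`, `IsTransverselyOriented.exists_strictMonoOn_transition`),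
and consequently so is every holonomy germ (Hector–Hirsch A, Ch. II 2.2.9 (i)–(ii): for a
transversely oriented foliation the holonomy takes values in the orientation preserving germs;
Camacho–Lins Neto, *Geometric Theory of Foliations*, Ch. IV §1, Remark): this is what makes
one-sided ("positive", "negative") holonomy and positive vanishing cycles meaningful
(Camacho–Lins Neto, Ch. VII §2).

* `Foliation.IsIncrHomeoGermAt φ t` (**definition**): `φ` is an *increasing* homeomorphism germ
  at `t` (continuous and strictly increasing on an open interval around `t`); such germs are
  homeomorphism germs, compose, and have increasing inverse germs
  (`IsIncrHomeoGermAt.exists_inverse`).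
* `Foliation.GermSpace.IsIncr d` (**definition**): the distinguished germ `d` is the germ of
  `φ ∘ h_e` with `φ` increasing, for some flow box `e` of the atlas; for a transversely
  oriented atlas this holds in *every* box around the base point (`IsIncr.exists_eq`), the
  increasing germs form an open and closed subset of the germ space
  (`isClopen_setOf_isIncr`), so they are preserved along paths in the germ space
  (`IsIncr.of_path`).
* **Holonomy germs of transversely oriented foliations are increasing**
  (`exists_isIncrHomeoGermAt_holonomyGerm_eq`): the continuation of `h_{e₀}` along any leaf
  path is an increasing distinguished germ (`isIncr_continuation`), hence the holonomy germ
  read in any box `e₁` has a representative that is continuous and strictly increasing near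
  `h_{e₁}(q)`. [cite: HectorHirsch1986, Ch. II 2.2.9]

## References

* G. Hector, U. Hirsch, *Introduction to the Geometry of Foliations, Part A*, 2nd ed., Vieweg
  (1986), Ch. II Def. 2.2.8, 2.2.9 [HectorHirsch1986].
* C. Camacho, A. Lins Neto, *Geometric Theory of Foliations*, Birkhäuser (1985), Ch. IV §1,
  Ch. VII §2 [CamachoLinsNeto1985].

## Design notes

* Everything is proved; no smoothness. `B` nonempty and locally connected where the germ
  covering is used.
-/
open scoped Topology
open Function Set Filter Topology

namespace Literature.Topology.FourManifolds

namespace Foliation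

variable {B : Type*} [TopologicalSpace B] {M : Type*} [TopologicalSpace M]
variable {e e' e₀ e₁ : OpenPartialHomeomorph M (B × ℝ)} {t : ℝ} {z : M}

-- BODY
/-! ## Increasing homeomorphism germs -/

/-- `φ : ℝ → ℝ` is an **increasing homeomorphism germ at `t`**: continuous and strictly
increasing on some open interval around `t`. [folklore] -/
def IsIncrHomeoGermAt (φ : ℝ → ℝ) (t : ℝ) : Prop :=
  ∃ ε > (0 : ℝ), ContinuousOn φ (Ioo (t - ε) (t + ε)) ∧ StrictMonoOn φ (Ioo (t - ε) (t + ε))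

namespace IsIncrHomeoGermAt

variable {φ χ : ℝ → ℝ} {t : ℝ}

/-- An increasing homeomorphism germ is a homeomorphism germ. [folklore] -/
theorem isHomeoGermAt (h : IsIncrHomeoGermAt φ t) : IsHomeoGermAt φ t := by
  obtain ⟨ε, hε, hc, hm⟩ := h
  exact ⟨ε, hε, hc, Or.inl hm⟩

/-- The identity is an increasing homeomorphism germ. [folklore] -/
theorem id (t : ℝ) : IsIncrHomeoGermAt id t := ⟨1, one_pos, continuousOn_id, strictMonoOn_id⟩

/-- A homeomorphism germ which is eventually strictly increasing near `t` is an increasing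
homeomorphism germ (a strictly decreasing function on an interval is not increasing on any
subinterval). [folklore] -/
theorem of_isHomeoGermAt (h : IsHomeoGermAt φ t) {δ : ℝ} (hδ : 0 < δ)
    (hm : StrictMonoOn φ (Ioo (t - δ) (t + δ))) : IsIncrHomeoGermAt φ t := by
  obtain ⟨ε, hε, hc, -⟩ := h
  refine ⟨min ε δ, lt_min hε hδ, hc.mono (Ioo_subset_Ioo (by linarith [min_le_left ε δ])
    (by linarith [min_le_left ε δ])), hm.mono (Ioo_subset_Ioo (by linarith [min_le_right ε δ])
    (by linarith [min_le_right ε δ]))⟩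

/-- **Increasing homeomorphism germs compose.** [folklore] -/
theorem comp (hχ : IsIncrHomeoGermAt χ (φ t)) (hφ : IsIncrHomeoGermAt φ t) :
    IsIncrHomeoGermAt (χ ∘ φ) t := by
  obtain ⟨ε₂, hε₂, hc₂, hm₂⟩ := hχ
  obtain ⟨ε₁, hε₁, hc₁, hm₁⟩ := hφ
  have hca : ContinuousAt φ t := hc₁.continuousAt (IsHomeoGermAt.Ioo_mem_nhds_of_pos hε₁)
  obtain ⟨δ, hδ, hδsub⟩ := IsHomeoGermAt.exists_Ioo_subset_of_mem_nhds (inter_mem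
    (IsHomeoGermAt.Ioo_mem_nhds_of_pos hε₁)
    (hca.preimage_mem_nhds (IsHomeoGermAt.Ioo_mem_nhds_of_pos hε₂)))
  have hδε : Ioo (t - δ) (t + δ) ⊆ Ioo (t - ε₁) (t + ε₁) := fun τ hτ ↦ (hδsub hτ).1
  have hmaps : MapsTo φ (Ioo (t - δ) (t + δ)) (Ioo (φ t - ε₂) (φ t + ε₂)) := fun τ hτ ↦ (hδsub hτ).2
  exact ⟨δ, hδ, hc₂.comp (hc₁.mono hδε) hmaps, hm₂.comp (hm₁.mono hδε) hmaps⟩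

/-- **The inverse germ of an increasing homeomorphism germ is increasing.** [folklore] -/
theorem exists_inverse (hφ : IsIncrHomeoGermAt φ t) :
    ∃ ψ : ℝ → ℝ, IsIncrHomeoGermAt ψ (φ t) ∧ ψ (φ t) = t ∧ ψ ∘ φ =ᶠ[𝓝 t] _root_.id ∧
      φ ∘ ψ =ᶠ[𝓝 (φ t)] _root_.id := by
  obtain ⟨ψ, hψ, hval, h₁, h₂⟩ := hφ.isHomeoGermAt.exists_inverse
  refine ⟨ψ, ?_, hval, h₁, h₂⟩
  -- `ψ` is monotone or antitone near `φ t`; antitone is impossible since `ψ ∘ φ = id` near `t`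
  obtain ⟨ε, hε, hc, hm | hm⟩ := hψ
  · exact ⟨ε, hε, hc, hm⟩
  · exfalso
    obtain ⟨ε₁, hε₁, hc₁, hm₁⟩ := hφ
    have hca : ContinuousAt φ t := hc₁.continuousAt (IsHomeoGermAt.Ioo_mem_nhds_of_pos hε₁)
    -- a small interval around `t` mapped by `φ` into the interval of `ψ`, on which `ψ ∘ φ = id`
    obtain ⟨δ, hδ, hδsub⟩ := IsHomeoGermAt.exists_Ioo_subset_of_mem_nhds (inter_mem
      (inter_mem (IsHomeoGermAt.Ioo_mem_nhds_of_pos hε₁) h₁)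
      (hca.preimage_mem_nhds (IsHomeoGermAt.Ioo_mem_nhds_of_pos hε)))
    have ha : t - δ / 2 ∈ Ioo (t - δ) (t + δ) := ⟨by linarith, by linarith⟩
    have hb : t + δ / 2 ∈ Ioo (t - δ) (t + δ) := ⟨by linarith, by linarith⟩
    have hlt : φ (t - δ / 2) < φ (t + δ / 2) := hm₁ (hδsub ha).1.1 (hδsub hb).1.1 (by linarith)
    have hanti : ψ (φ (t + δ / 2)) < ψ (φ (t - δ / 2)) := hm (hδsub ha).2 (hδsub hb).2 hlt
    have e₁ : ψ (φ (t - δ / 2)) = t - δ / 2 := (hδsub ha).1.2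
    have e₂ : ψ (φ (t + δ / 2)) = t + δ / 2 := (hδsub hb).1.2
    rw [e₁, e₂] at hanti
    linarith

/-- Increasing homeomorphism germs depend only on the germ. [folklore] -/
theorem congr {φ' : ℝ → ℝ} (hφ : IsIncrHomeoGermAt φ t) (h : φ =ᶠ[𝓝 t] φ') : IsIncrHomeoGermAt φ' t := by
  obtain ⟨ε, hε, hc, hm⟩ := hφ
  obtain ⟨δ, hδ, hδsub⟩ := IsHomeoGermAt.exists_Ioo_subset_of_mem_nhds
    (inter_mem (IsHomeoGermAt.Ioo_mem_nhds_of_pos hε) h)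
  have hδε : Ioo (t - δ) (t + δ) ⊆ Ioo (t - ε) (t + ε) := fun τ hτ ↦ (hδsub hτ).1
  have heq : EqOn φ φ' (Ioo (t - δ) (t + δ)) := fun τ hτ ↦ (hδsub hτ).2
  exact ⟨δ, hδ, (hc.mono hδε).congr heq.symm, (hm.mono hδε).congr heq⟩

end IsIncrHomeoGermAt

variable (F : Foliation B M)

variable {F} in
/-- **For a transversely oriented atlas the transition germs are increasing homeomorphism
germs.** [cite: HectorHirsch1986, Ch. II Def. 2.2.8] -/
theorem IsTransverselyOriented.isIncrHomeoGermAt_transition (ho : F.IsTransverselyOriented)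
    (he : e ∈ F.atlas) (he' : e' ∈ F.atlas) (hz : z ∈ e.source) (hz' : z ∈ e'.source) :
    IsIncrHomeoGermAt (transition e e' z) (e z).2 := by
  obtain ⟨ε, hε, hsrc, hm⟩ := ho.exists_strictMonoOn_transition he he' hz hz'
  exact ⟨ε, hε, fun τ hτ ↦ (F.continuousAt_transition_of_mem he (hsrc τ hτ)).continuousWithinAt, hm⟩

/-! ## Increasing distinguished germs -/

namespace GermSpace

variable {F}

/-- The distinguished germ `d` is **increasing**: it is the germ of `φ ∘ h_e` with `φ` an
increasing homeomorphism germ, for some flow box `e` of the atlas around its base point.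
[folklore] -/
def IsIncr (d : F.GermSpace) : Prop :=
  ∃ e ∈ F.atlas, ∃ _ : ofLeafSpace d.pt ∈ e.source, ∃ φ : ℝ → ℝ,
    IsIncrHomeoGermAt φ (e (ofLeafSpace d.pt)).2 ∧ d.germ = ↑(φ ∘ height e)

/-- The germ of a distinguished map is increasing. [folklore] -/
theorem isIncr_ofHeight (he : e ∈ F.atlas) (q : F.LeafSpace) (hq : ofLeafSpace q ∈ e.source) :
    IsIncr (ofHeight F he q hq) :=
  ⟨e, he, hq, id, IsIncrHomeoGermAt.id _, rfl⟩

/-- **For a transversely oriented atlas, increasing distinguished germs are increasing in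
every box** around the base point (the transition germs being increasing). [folklore] -/
theorem IsIncr.exists_eq (ho : F.IsTransverselyOriented) {d : F.GermSpace} (hd : IsIncr d)
    (he' : e' ∈ F.atlas) (hz' : ofLeafSpace d.pt ∈ e'.source) :
    ∃ φ : ℝ → ℝ, IsIncrHomeoGermAt φ (e' (ofLeafSpace d.pt)).2 ∧ d.germ = ↑(φ ∘ height e') := by
  obtain ⟨e, he, hz, φ, hφ, hG⟩ := hd
  refine ⟨φ ∘ transition e' e (ofLeafSpace d.pt), ?_, ?_⟩
  · refine IsIncrHomeoGermAt.comp ?_ (ho.isIncrHomeoGermAt_transition he' he hz' hz)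
    rwa [transition_apply_height e hz']
  · rw [hG, Germ.coe_eq]
    exact (F.height_eventuallyEq_transition_comp_height he' he hz' hz).fun_comp φ

/-- A section `germ (φ ∘ h_e)` consists of increasing germs if `φ` is an increasing germ.
[folklore] -/
theorem isIncr_germSection (he : e ∈ F.atlas) (t : ℝ) {φ : ℝ → ℝ} (hφ : IsHomeoGermAt φ t)
    (hφi : IsIncrHomeoGermAt φ t) (b : B) : IsIncr (F.germSection he t hφ b) := by
  refine ⟨e, he, F.plaqueMap_mem_source he t b, φ, ?_, rfl⟩
  rw [show (e (ofLeafSpace (F.germSection he t hφ b).pt)).2 = t from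
    congrArg Prod.snd (F.apply_plaqueMap he t b)]
  exact hφi

/-- For a transversely oriented atlas, if one germ of a section `germ (φ ∘ h_e)` is increasing
then `φ` is an increasing germ (read through the box `e` of the section). [folklore] -/
theorem isIncrHomeoGermAt_of_isIncr_germSection (ho : F.IsTransverselyOriented) (he : e ∈ F.atlas)
    (t : ℝ) {φ : ℝ → ℝ} (hφ : IsHomeoGermAt φ t) {b : B} (h : IsIncr (F.germSection he t hφ b)) :
    IsIncrHomeoGermAt φ t := by
  obtain ⟨φ', hφ', hG⟩ := h.exists_eq ho he (F.plaqueMap_mem_source he t b)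
  have ht : (e (ofLeafSpace (F.germSection he t hφ b).pt)).2 = t :=
    congrArg Prod.snd (F.apply_plaqueMap he t b)
  rw [ht] at hφ'
  -- the two representatives have the same germ at `t`
  have heq : φ' =ᶠ[𝓝 t] φ := by
    have h₁ := F.eventuallyEq_of_comp_height_eq he (F.plaqueMap_mem_source he t b) hG.symm
    rwa [show (e (plaqueMap e t b)).2 = t from congrArg Prod.snd (F.apply_plaqueMap he t b)] at h₁
  exact hφ'.congr heq

/-- **The increasing germs form an open subset of the germ space** (along each section, all or
none of the germs are increasing). [folklore] -/
theorem isOpen_setOf_isIncr (ho : F.IsTransverselyOriented) : IsOpen {d : F.GermSpace | IsIncr d} := by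
  refine GermSpace.isOpen_iff.2 fun e he t φ hφ ↦ ?_
  by_cases h : IsIncrHomeoGermAt φ t
  · have : F.germSection he t hφ ⁻¹' {d | IsIncr d} = univ :=
      eq_univ_of_forall fun b ↦ isIncr_germSection he t hφ h b
    rw [this]
    exact isOpen_univ
  · have : F.germSection he t hφ ⁻¹' {d | IsIncr d} = ∅ :=
      eq_empty_of_forall_notMem fun b hb ↦ h (isIncrHomeoGermAt_of_isIncr_germSection ho he t hφ hb)
    rw [this]
    exact isOpen_empty

/-- **The increasing germs form a closed subset of the germ space.** [folklore] -/
theorem isClosed_setOf_isIncr (ho : F.IsTransverselyOriented) : IsClosed {d : F.GermSpace | IsIncr d} := by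
  rw [← isOpen_compl_iff]
  refine GermSpace.isOpen_iff.2 fun e he t φ hφ ↦ ?_
  by_cases h : IsIncrHomeoGermAt φ t
  · have : F.germSection he t hφ ⁻¹' {d | IsIncr d}ᶜ = ∅ :=
      eq_empty_of_forall_notMem fun b hb ↦ hb (isIncr_germSection he t hφ h b)
    rw [this]
    exact isOpen_empty
  · have : F.germSection he t hφ ⁻¹' {d | IsIncr d}ᶜ = univ :=
      eq_univ_of_forall fun b hb ↦ h (isIncrHomeoGermAt_of_isIncr_germSection ho he t hφ hb)
    rw [this]
    exact isOpen_univ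

/-- The increasing germs form an open and closed subset of the germ space. [folklore] -/
theorem isClopen_setOf_isIncr (ho : F.IsTransverselyOriented) : IsClopen {d : F.GermSpace | IsIncr d} :=
  ⟨isClosed_setOf_isIncr ho, isOpen_setOf_isIncr ho⟩

/-- **Increasing germs are preserved along paths in the germ space** (e.g. along lifts of
leaf paths). [folklore] -/
theorem IsIncr.of_path (ho : F.IsTransverselyOriented) (Γ : C(unitInterval, F.GermSpace))
    (h : IsIncr (Γ 0)) (s : unitInterval) : IsIncr (Γ s) := by
  have hU : IsClopen (Γ ⁻¹' {d | IsIncr d}) := (isClopen_setOf_isIncr ho).preimage Γ.continuous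
  rcases isClopen_iff.1 hU with hU | hU
  · have : (0 : unitInterval) ∈ Γ ⁻¹' {d | IsIncr d} := h
    rw [hU] at this
    exact absurd this (notMem_empty _)
  · have : s ∈ Γ ⁻¹' {d | IsIncr d} := by
      rw [hU]
      exact mem_univ s
    exact this

end GermSpace

/-! ## Holonomy germs of transversely oriented foliations are increasing -/

section Holonomy

variable [Nonempty B] [LocallyConnectedSpace B]
variable {p q : F.LeafSpace}

/-- **The continuation of a distinguished map along a leaf path is an increasing germ**, for a
transversely oriented atlas. [folklore] -/
theorem isIncr_continuation (ho : F.IsTransverselyOriented) (he₀ : e₀ ∈ F.atlas)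
    (hp : ofLeafSpace p ∈ e₀.source) (γ : Path.Homotopic.Quotient p q) :
    GermSpace.IsIncr (F.continuation he₀ hp γ) := by
  induction γ using Path.Homotopic.Quotient.ind with
  | mk γ =>
    rw [continuation_mk]
    refine GermSpace.IsIncr.of_path ho _ ?_ 1
    rw [(F.isCoveringMap_proj).liftPath_zero]
    exact GermSpace.isIncr_ofHeight he₀ p hp

/-- **Holonomy germs of a transversely oriented foliation are increasing**: the holonomy germ
of any leaf path, read in boxes `e₀ ∋ p`, `e₁ ∋ q` of the atlas, has a representative which is
continuous and strictly increasing near `h_{e₁}(q)` and takes it to `h_{e₀}(p)` (Hector–Hirsch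
A, Ch. II 2.2.9 (i)–(ii): the holonomy of a transversely oriented foliation preserves the
transverse orientation). [cite: HectorHirsch1986, Ch. II 2.2.9] -/
theorem exists_isIncrHomeoGermAt_holonomyGerm_eq (ho : F.IsTransverselyOriented) (he₀ : e₀ ∈ F.atlas)
    (hp : ofLeafSpace p ∈ e₀.source) (γ : Path.Homotopic.Quotient p q) (he₁ : e₁ ∈ F.atlas)
    (hq : ofLeafSpace q ∈ e₁.source) :
    ∃ ψ : ℝ → ℝ, IsIncrHomeoGermAt ψ (e₁ (ofLeafSpace q)).2 ∧ F.holonomyGerm he₀ hp γ he₁ hq = ↑ψ ∧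
      ψ (e₁ (ofLeafSpace q)).2 = (e₀ (ofLeafSpace p)).2 := by
  obtain ⟨ψ, -, hψe, hval⟩ := F.exists_isHomeoGermAt_holonomyGerm_eq he₀ hp γ he₁ hq
  refine ⟨ψ, ?_, hψe, hval⟩
  -- the continuation is an increasing germ; read it through `e₁`
  have hq' : ofLeafSpace (F.continuation he₀ hp γ).pt ∈ e₁.source := by
    rw [continuation_pt]
    exact hq
  obtain ⟨φ, hφ, hG⟩ := (F.isIncr_continuation ho he₀ hp γ).exists_eq ho he₁ hq'
  -- `continuation = ψ ∘ h_{e₁}` as germs, hence `ψ = φ` as germs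
  have hw := F.writeGerm_holonomyGerm he₀ hp γ he₁ hq
  rw [hψe, writeGerm_coe, hG] at hw
  have heq : ψ =ᶠ[𝓝 (e₁ (ofLeafSpace (F.continuation he₀ hp γ).pt)).2] φ :=
    F.eventuallyEq_of_comp_height_eq he₁ hq' hw
  have hpt : (e₁ (ofLeafSpace (F.continuation he₀ hp γ).pt)).2 = (e₁ (ofLeafSpace q)).2 := by
    rw [continuation_pt]
  rw [hpt] at heq hφ
  exact hφ.congr heq.symm

end Holonomy

end Foliation

end Literature.Topology.FourManifolds
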